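import Literature.NumberTheory.GaloisRepresentations.ContinuousCohomologyIntCoefficients
import Mathlib.Topology.Algebra.Group.TopologicalAbelianization
import HarnessLib

/-!
# Continuous characters factor through the topological abelianization:
# `Hom_cont(G, A) = Hom_cont(G^ab, A)` and `H²(G, ℤ) ≅ Hom_cont(G^ab, ℚ/ℤ) = (G^ab)^∨`

Topic `NumberTheory/GaloisRepresentations`; namespace `Literature.NumberTheory.GaloisRepresentations`.
For a topological group `G`, Mathlib's `TopologicalAbelianization G = G ⧸ closure [G, G]`, and a
DISCRETE abelian group `A` with trivial action, the continuous homomorphisms `G → A` — the tree's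
continuous `1`-cocycles `contOneCocycles` of the trivial module — are the same as those of `G^ab`:
a continuous `χ : G → A` kills commutators (`A` abelian) and its kernel is open, hence closed, hence
contains `closure [G, G]`.

* `abelianizationMk G : G →ₜ* G^ab`;
* `commutatorClosure_le_oneCocycleKer` — `closure [G,G] ≤ ker χ`;
* `contOneCocycles.descendAb χ` — the character of `G^ab` induced by `χ`, and the linear equivalence
  **`contOneCocyclesAbelianizationEquiv : Hom_cont(G^ab, A) ≃ₗ[ℤ] Hom_cont(G, A)`** (pull-back along
  `G → G^ab`; inverse `descendAb`);
* **`H2IntEquivHomAbelianization G : H²(G, ℤ) ≃ₗ[ℤ] Hom_cont(G^ab, ℚ/ℤ)`** for `G` profinite — the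
  Pontryagin-dual form "`H²(G, ℤ) ≅ (G^ab)^∨`" of the trunk's `H2IntEquivHom` (inverse Bockstein),
  the shape dual to the reciprocity isomorphism of local class field theory
  (Serre, *Local Fields* XIII §1; Cassels–Fröhlich VI §1.1–§2).

Honest framing: classical; nothing here bears on abc or takes a side on [IUTchIII] Cor. 3.12.

## References
* J.-P. Serre, *Local Fields* (1979), XIII §1. [SerreLocalFields1979]
* J. W. S. Cassels, A. Fröhlich (eds.), *Algebraic Number Theory* (1967), Ch. VI §1–§2.
  [CasselsFrohlichANT1967]
-/

noncomputable section

open CategoryTheory Function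

universe u

namespace Literature.NumberTheory.GaloisRepresentations

open _root_.TopRep _root_.ContRepresentation _root_.ContinuousCohomology _root_.Topology

section Abelianization

variable (G : Type u) [Group G] [TopologicalSpace G] [IsTopologicalGroup G]
variable {A : Type u} [AddCommGroup A] [TopologicalSpace A] [DiscreteTopology A]

/-- The quotient map `G → G^ab = G ⧸ closure [G, G]` as a continuous homomorphism.
[cite: SerreLocalFields1979, XIII §1] -/
def abelianizationMk : G →ₜ* TopologicalAbelianization G :=
  ⟨QuotientGroup.mk' _, QuotientGroup.continuous_mk⟩

/-- `abelianizationMk G g = ḡ`. [cite: SerreLocalFields1979, XIII §1] -/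
@[simp] theorem abelianizationMk_apply (g : G) :
    abelianizationMk G g = (QuotientGroup.mk g : TopologicalAbelianization G) := rfl

variable {G}

/-- A continuous character `χ : G → A` (trivial discrete `A`) as a group homomorphism into
`Multiplicative A`. [cite: SerreLocalFields1979, XIII §1] -/
def contOneCocycles.toMonoidHomOfTrivial (χ : contOneCocycles (ContinuousRep.trivial G ℤ A).toTopRep) :
    G →* Multiplicative A where
  toFun g := Multiplicative.ofAdd (χ.1 g)
  map_one' := by rw [contOneCocycles.apply_one]; rfl
  map_mul' a b := by rw [contOneCocycles.apply_mul_of_trivial (fun _ _ => rfl)]; rfl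

omit [IsTopologicalGroup G] in
/-- `toMonoidHomOfTrivial χ g = χ g`. [cite: SerreLocalFields1979, XIII §1] -/
@[simp] theorem contOneCocycles.toMonoidHomOfTrivial_apply
    (χ : contOneCocycles (ContinuousRep.trivial G ℤ A).toTopRep) (g : G) :
    contOneCocycles.toMonoidHomOfTrivial χ g = Multiplicative.ofAdd (χ.1 g) := rfl

/-- **`closure [G, G] ≤ ker χ`** for a continuous character into a discrete abelian group: commutators
die in the abelian target, and the kernel (`oneCocycleKer χ`, open) is closed.
[cite: SerreLocalFields1979, XIII §1] -/
theorem commutatorClosure_le_oneCocycleKer (χ : contOneCocycles (ContinuousRep.trivial G ℤ A).toTopRep) :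
    (commutator G).topologicalClosure ≤ oneCocycleKer χ := by
  have hker : commutator G ≤ oneCocycleKer χ := by
    have h1 : commutator G ≤ (contOneCocycles.toMonoidHomOfTrivial χ).ker := by
      rw [commutator_eq_closure, Subgroup.closure_le]
      rintro x ⟨a, b, rfl⟩
      rw [SetLike.mem_coe, MonoidHom.mem_ker, map_commutatorElement, commutatorElement_eq_one_iff_mul_comm,
        mul_comm]
    intro x hx
    rw [mem_oneCocycleKer_iff]
    have h2 := h1 hx
    rw [MonoidHom.mem_ker, contOneCocycles.toMonoidHomOfTrivial_apply] at h2
    exact Multiplicative.ofAdd.injective h2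
  refine Subgroup.topologicalClosure_minimal _ hker ?_
  exact (OpenSubgroup.isClosed ⟨oneCocycleKer χ, isOpen_oneCocycleKer χ⟩)

/-- **The character of `G^ab` induced by a continuous character of `G`** (trivial discrete `A`).
[cite: SerreLocalFields1979, XIII §1] -/
def contOneCocycles.descendAb (χ : contOneCocycles (ContinuousRep.trivial G ℤ A).toTopRep) :
    contOneCocycles (ContinuousRep.trivial (TopologicalAbelianization G) ℤ A).toTopRep :=
  let ψ : TopologicalAbelianization G →* Multiplicative A :=
    QuotientGroup.lift _ (contOneCocycles.toMonoidHomOfTrivial χ) fun x hx => by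
      rw [MonoidHom.mem_ker, contOneCocycles.toMonoidHomOfTrivial_apply,
        (mem_oneCocycleKer_iff χ x).mp (commutatorClosure_le_oneCocycleKer χ hx)]
      rfl
  ⟨⟨fun q => Multiplicative.toAdd (ψ q), by
      have hψ : Continuous ψ := by
        rw [(QuotientGroup.isQuotientMap_mk ((commutator G).topologicalClosure)).continuous_iff]
        exact (continuous_ofAdd.comp χ.1.continuous).congr fun _ => rfl
      exact continuous_toAdd.comp hψ⟩,
    fun a b => by
      change Multiplicative.toAdd (ψ (a * b)) = Multiplicative.toAdd (ψ a) +
        (ContinuousRep.trivial (TopologicalAbelianization G) ℤ A).toTopRep.ρ a (Multiplicative.toAdd (ψ b))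
      rw [map_mul, toAdd_mul]
      rfl⟩

/-- `descendAb χ ḡ = χ g`. [cite: SerreLocalFields1979, XIII §1] -/
@[simp] theorem contOneCocycles.descendAb_apply_mk
    (χ : contOneCocycles (ContinuousRep.trivial G ℤ A).toTopRep) (g : G) :
    (contOneCocycles.descendAb χ).1 (QuotientGroup.mk g : TopologicalAbelianization G) = χ.1 g := rfl

variable (G) in
/-- **`Hom_cont(G^ab, A) ≃ₗ[ℤ] Hom_cont(G, A)`** (trivial discrete `A`): pull-back along `G → G^ab`, with
inverse `descendAb` — continuous characters factor uniquely through the topological abelianization.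
[cite: SerreLocalFields1979, XIII §1] -/
def contOneCocyclesAbelianizationEquiv (A : Type u) [AddCommGroup A] [TopologicalSpace A]
    [DiscreteTopology A] :
    contOneCocycles (ContinuousRep.trivial (TopologicalAbelianization G) ℤ A).toTopRep ≃ₗ[ℤ]
      contOneCocycles (ContinuousRep.trivial G ℤ A).toTopRep where
  toFun ψ := contOneCocycles.pullback (abelianizationMk G)
    (𝟙 ((ContinuousRep.trivial G ℤ A).toTopRep)) ψ
  map_add' _ _ := rfl
  map_smul' _ _ := rfl
  invFun χ := contOneCocycles.descendAb χ
  left_inv ψ := by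
    refine Subtype.ext (ContinuousMap.ext fun q => ?_)
    obtain ⟨g, rfl⟩ := QuotientGroup.mk_surjective q
    rfl
  right_inv χ := by
    refine Subtype.ext (ContinuousMap.ext fun g => ?_)
    rfl

/-- `(contOneCocyclesAbelianizationEquiv ψ)(g) = ψ(ḡ)`. [cite: SerreLocalFields1979, XIII §1] -/
@[simp] theorem contOneCocyclesAbelianizationEquiv_apply_apply
    (ψ : contOneCocycles (ContinuousRep.trivial (TopologicalAbelianization G) ℤ A).toTopRep) (g : G) :
    (contOneCocyclesAbelianizationEquiv G A ψ).1 g =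
      ψ.1 (QuotientGroup.mk g : TopologicalAbelianization G) := rfl

/-- `((contOneCocyclesAbelianizationEquiv)⁻¹ χ)(ḡ) = χ(g)`. [cite: SerreLocalFields1979, XIII §1] -/
@[simp] theorem contOneCocyclesAbelianizationEquiv_symm_apply_mk
    (χ : contOneCocycles (ContinuousRep.trivial G ℤ A).toTopRep) (g : G) :
    ((contOneCocyclesAbelianizationEquiv G A).symm χ).1
        (QuotientGroup.mk g : TopologicalAbelianization G) = χ.1 g := rfl

end Abelianization

section H2

variable (G : Type u) [Group G] [TopologicalSpace G] [IsTopologicalGroup G] [CompactSpace G]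
  [T2Space G] [TotallyDisconnectedSpace G]

/-- **`H²(G, ℤ) ≅ Hom_cont(G^ab, ℚ/ℤ) = (G^ab)^∨`** for a profinite group `G`: the trunk's inverse
Bockstein `H2IntEquivHom G : H²(G, ℤ) ≃ₗ[ℤ] Hom_cont(G, ℚ/ℤ)` followed by the factorization of
characters through the topological abelianization. [cite: SerreLocalFields1979, XIII §1] -/
def H2IntEquivHomAbelianization :
    continuousCohomology 2 (ContinuousRep.trivial G ℤ ZCoeff.{u}).toTopRep ≃ₗ[ℤ]
      contOneCocycles (ContinuousRep.trivial (TopologicalAbelianization G) ℤ QModZCoeff.{u}).toTopRep :=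
  (H2IntEquivHom G) ≪≫ₗ (contOneCocyclesAbelianizationEquiv G QModZCoeff.{u}).symm

/-- `(H2IntEquivHomAbelianization c)(ḡ) = (H2IntEquivHom G c)(g)`. [cite: SerreLocalFields1979, XIII §1] -/
@[simp] theorem H2IntEquivHomAbelianization_apply_mk
    (c : continuousCohomology 2 (ContinuousRep.trivial G ℤ ZCoeff.{u}).toTopRep) (g : G) :
    (H2IntEquivHomAbelianization G c).1 (QuotientGroup.mk g : TopologicalAbelianization G) =
      (H2IntEquivHom G c).1 g := rfl

end H2

end Literature.NumberTheory.GaloisRepresentations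

end
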